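import Literature.NumberTheory.EllipticCurves.HondaStrongIsomorphismProofs
import Literature.NumberTheory.EllipticCurves.FormalGroupFrobeniusTypeAllPrimesProofs
import HarnessLib

/-!
# Honda's theorem at EVERY good prime (`p = 2` included): the formal group of `E/ℤ_p` is strongly
# isomorphic over `ℤ_p` to the formal group of `L(E, s)` (Honda 1970, Thm. 9; proofs only)

Topic `NumberTheory/EllipticCurves` (theorems only; no definition, no named fact). The files
`EichlerShimuraCongruenceHondaProofs` (`norm_coeff_hondaShift_subst_formalLog_le_one`,
`norm_coeff_hondaShift_formalLog_subst_of_variableChange`) and `HondaStrongIsomorphismProofs`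
(`exists_padicInt_formalLog_subst_eq_lSeriesLog`) assume the good prime `p` ODD, only because
Honda's congruences for `log_E` were (`FormalGroupFrobeniusTypeProofs`, through the `char ≠ 2`
dictionary of `FormalGroupLaurentPoints`). With `norm_coeff_hondaShift_formalLog_le_one'`
(`FormalGroupFrobeniusTypeAllPrimesProofs`, every `p`) the same proofs give, for a globally minimal
elliptic `W/ℚ` and EVERY prime `p ∤ Δ_min(W)`:

* `norm_coeff_hondaShift_subst_formalLog_le_one'`: `log_{W ⊗ ℚ_p}(θ)` is of Honda type
  `p − a_pT + T²`, `a_p = frobeniusTrace W p`, for every `θ ∈ Xℤ_p⟦X⟧`;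
* `norm_coeff_hondaShift_formalLog_subst_of_variableChange'`: the same for a `p`-integral model
  `W₀` with `C • W₀` globally minimal, `C` `p`-integral with `u ∈ ℤ_pˣ`;
* `exists_padicInt_formalLog_subst_eq_lSeriesLog'`: **Honda 1970, Thm. 9** — there is
  `ψ ∈ Xℤ_p⟦X⟧` with `log_{W ⊗ ℚ_p}(ψ) = Σₙ aₙ(W) Xⁿ/n`.

The last is input (ii) ("Honda for `W'` alone") at a good prime `p = 2` of the finite-height route to
the integrality of the Manin constant (`NeronIsogenyScaling.lean`, "A finite-height refinement"; fact
`edixhoven_int_of_neronLattice_eq_smul_periodLattice`), whose input (i) at `p = 2` is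
`exists_isUnit_coeff_formalMul_subst'`.

## References

* T. Honda, *On the theory of commutative formal groups*, J. Math. Soc. Japan 22 (1970), 213–246:
  Thm. 2 (p. 223), §6.2 Thm. 9 (pp. 240–241). [Honda1970]
* T. Honda, *Formal groups and zeta-functions*, Osaka J. Math. 5 (1968), Thm. 5.
* M. Hazewinkel, *Formal Groups and Applications* (1978), Ch. I §2.2, §33.1. [Hazewinkel1978]
* J. H. Silverman, *The Arithmetic of Elliptic Curves*, 2nd ed. (2009), Thm. V.2.3.1(b), IV.5.
  [cite: SilvermanAEC2009]
-/

noncomputable section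

open scoped Classical

namespace WeierstrassCurve

open PowerSeries Literature.RingTheory.FormalGroups Literature.NumberTheory.EllipticCurves
open ArithmeticFunction IsDedekindDomain NumberField Rat.HeightOneSpectrum

variable {p : ℕ} [hp : Fact p.Prime]

/-- **The formal logarithm of `E/ℚ_p` read through an integral parameter is of Honda type
`p − a_pT + T²`, `a_p = frobeniusTrace`, at EVERY good prime** (globally minimal `E`, `p ∤ Δ_min`,
`p = 2` included): `norm_coeff_hondaShift_formalLog_le_one'` on the `ℤ_p`-model and Honda's transport
lemma (iii); as `norm_coeff_hondaShift_subst_formalLog_le_one` without `p ≠ 2`.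
[Honda 1970, Thm. 9 (proof)] [cite: Honda1970, Thm. 9 (pp. 240–241)] -/
theorem norm_coeff_hondaShift_subst_formalLog_le_one' (W : WeierstrassCurve ℚ) [W.IsElliptic]
    [W.IsGloballyMinimal] (hgood : ¬ (p : ℤ) ∣ minimalDiscriminantInt W) {θ : ℚ_[p]⟦X⟧}
    (hθ0 : constantCoeff θ = 0) (hθ : ∀ n, ‖coeff n θ‖ ≤ 1) (n : ℕ) :
    ‖coeff n (hondaShift p (W.frobeniusTrace p : ℚ_[p]) ((W.map (algebraMap ℚ ℚ_[p])).formalLog.subst θ))‖ ≤ 1 := by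
  set V : WeierstrassCurve ℤ_[p] := (integralModelInt W).map (Int.castRingHom ℤ_[p]) with hV
  have hVc : V.map PadicInt.Coe.ringHom = W.map (algebraMap ℚ ℚ_[p]) := map_coe_integralModelInt W
  have hVt : V.map PadicInt.toZMod = (integralModelInt W).map (Int.castRingHom (ZMod p)) :=
    map_toZMod_integralModelInt W
  haveI hEc : (V.map PadicInt.Coe.ringHom).IsElliptic := by rw [hVc]; infer_instance
  haveI hEt' := isElliptic_reduction_of_not_dvd (p := p) W hgood
  haveI hEt : (V.map PadicInt.toZMod).IsElliptic := by rw [hVt]; infer_instance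
  have htr : HasseManin.tr (V.map PadicInt.toZMod) = W.frobeniusTrace p := tr_eq_frobeniusTrace W hVt
  have H2 := V.norm_coeff_hondaShift_formalLog_le_one'
  rw [htr] at H2
  have H2' : ∀ m, ‖coeff m (hondaShift p (W.frobeniusTrace p : ℚ_[p]) (W.map (algebraMap ℚ ℚ_[p])).formalLog)‖ ≤ 1 := by
    intro m
    have h := H2 m
    rwa [hVc] at h
  exact norm_coeff_hondaShift_subst_le_one (Padic.norm_int_le_one _) H2' hθ0 hθ n

/-- **The type of `log_{W₀} ∘ z` for a (possibly non-minimal) `p`-integral model `W₀`, at EVERY good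
prime**: if `C • W₀` is globally minimal with good reduction at `p`, `C = (u, r, s, t)` is `p`-integral
with `u ∈ ℤ_pˣ`, and `z ∈ Xℤ_p⟦X⟧`, then `log_{W₀ ⊗ ℚ_p}(z)` is of Honda type `p − a_pT + T²`,
`a_p = frobeniusTrace (C • W₀) p`; as `norm_coeff_hondaShift_formalLog_subst_of_variableChange`
without `p ≠ 2`. [Honda 1970, Thm. 9 (proof)] [cite: Honda1970, Thm. 9 (pp. 240–241)] -/
theorem norm_coeff_hondaShift_formalLog_subst_of_variableChange' (W₀ : WeierstrassCurve ℚ)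
    [W₀.IsElliptic] (vc : VariableChange ℚ) [(vc • W₀).IsGloballyMinimal]
    (hgood : ¬ (p : ℤ) ∣ minimalDiscriminantInt (vc • W₀))
    (h₁ : ‖(W₀.a₁ : ℚ_[p])‖ ≤ 1) (h₂ : ‖(W₀.a₂ : ℚ_[p])‖ ≤ 1) (h₃ : ‖(W₀.a₃ : ℚ_[p])‖ ≤ 1)
    (h₄ : ‖(W₀.a₄ : ℚ_[p])‖ ≤ 1) (h₆ : ‖(W₀.a₆ : ℚ_[p])‖ ≤ 1)
    (hu : ‖((vc.u : ℚ) : ℚ_[p])‖ = 1) (hr : ‖(vc.r : ℚ_[p])‖ ≤ 1) (hs : ‖(vc.s : ℚ_[p])‖ ≤ 1)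
    (ht : ‖(vc.t : ℚ_[p])‖ ≤ 1) {z : ℚ_[p]⟦X⟧} (hz0 : constantCoeff z = 0) (hz : ∀ n, ‖coeff n z‖ ≤ 1) (n : ℕ) :
    ‖coeff n (hondaShift p ((vc • W₀).frobeniusTrace p : ℚ_[p])
      ((W₀.map (algebraMap ℚ ℚ_[p])).formalLog.subst z))‖ ≤ 1 := by
  set φ := algebraMap ℚ ℚ_[p] with hφ
  set W₀p := W₀.map φ with hW₀p
  set Cp := vc.map (φ : ℚ →+* ℚ_[p]) with hCp
  haveI : W₀p.IsIntegral ℤ_[p] :=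
    isIntegral_of_mem_subring W₀p (((PadicInt.mem_subring_iff (p := p)).mpr h₁)) (((PadicInt.mem_subring_iff (p := p)).mpr h₂))
      (((PadicInt.mem_subring_iff (p := p)).mpr h₃)) (((PadicInt.mem_subring_iff (p := p)).mpr h₄)) (((PadicInt.mem_subring_iff (p := p)).mpr h₆))
  have hmap : (vc • W₀).map φ = Cp • W₀p := by rw [hCp, hW₀p, map_variableChange]
  -- the parameter `θ_C(z)` of `C • W₀`
  set θ := W₀p.formalVariableChange Cp with hθ
  have hθi : IsPadicInt θ := by
    refine W₀p.isPadicInt_formalVariableChange Cp (le_of_eq ?_) ?_ ?_ ?_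
    · simpa [hCp, VariableChange.map] using hu
    · simpa [hCp, VariableChange.map] using hr
    · simpa [hCp, VariableChange.map] using hs
    · simpa [hCp, VariableChange.map] using ht
  have hzs : HasSubst z := HasSubst.of_constantCoeff_zero' hz0
  have hθz0 : constantCoeff (θ.subst z) = 0 :=
    (Literature.RingTheory.FormalGroups.constantCoeff_subst_of_constantCoeff_eq_zero hz0 _).trans
      (W₀p.constantCoeff_formalVariableChange Cp)
  have hθzi : ∀ m, ‖coeff m (θ.subst z)‖ ≤ 1 :=
    isPadicInt_iff_coeff.mp (hθi.powerSeries_subst (isPadicInt_iff_coeff.mpr hz) hzs)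
  have key := norm_coeff_hondaShift_subst_formalLog_le_one' (vc • W₀) hgood hθz0 hθzi
  -- `log_{C•W₀}(θ(z)) = u · log_{W₀}(z)`
  have hlog : ((vc • W₀).map φ).formalLog.subst (θ.subst z) = C ((Cp.u : ℚ_[p])) * (W₀p.formalLog.subst z) := by
    rw [hmap, hθ, ← subst_comp_subst_apply (W₀p.hasSubst_formalVariableChange Cp) hzs,
      W₀p.formalLog_variableChange_subst Cp, subst_mul hzs, Literature.NumberTheory.EllipticCurves.C_subst]
  have key' : ∀ m, ‖coeff m (hondaShift p ((vc • W₀).frobeniusTrace p : ℚ_[p])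
      (C ((Cp.u : ℚ_[p])) * (W₀p.formalLog.subst z)))‖ ≤ 1 := fun m => by
    have h := key m
    rwa [hlog] at h
  have hu' : ‖((Cp.u : ℚ_[p]))‖ = 1 := by simpa [hCp, VariableChange.map] using hu
  exact Literature.NumberTheory.EllipticCurves.HondaCongruence.norm_coeff_hondaShift_of_C_mul hu' key' n

/-- **Honda 1970, Thm. 9 at EVERY good prime (strong isomorphism over `ℤ_p`), `p = 2` included.**
For a globally minimal elliptic `W/ℚ` and a prime `p ∤ Δ_min(W)` there is `ψ ∈ Xℚ_p⟦X⟧` with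
`p`-integral coefficients such that `log_{W ⊗ ℚ_p}(ψ) = Σₙ aₙ(W) Xⁿ/n`: the formal group of `W` over
`ℤ_p` is strongly isomorphic over `ℤ_p` to the formal group of its `L`-series. As
`exists_padicInt_formalLog_subst_eq_lSeriesLog`, with the type of `log_W` from
`norm_coeff_hondaShift_subst_formalLog_le_one'`. [cite: Honda1970, Thm. 9 (pp. 240–241) and Thm. 2 (p. 223)] -/
theorem exists_padicInt_formalLog_subst_eq_lSeriesLog' (W : WeierstrassCurve ℚ)
    [W.IsElliptic] [W.IsGloballyMinimal] (hgood : ¬ (p : ℤ) ∣ minimalDiscriminantInt W) :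
    ∃ ψ : ℚ_[p]⟦X⟧, constantCoeff ψ = 0 ∧ (∀ n, ‖coeff n ψ‖ ≤ 1) ∧
      (W.map (algebraMap ℚ ℚ_[p])).formalLog.subst ψ =
        PowerSeries.mk fun k ↦ ((W.LFunction k : ℤ) : ℚ_[p]) / k := by
  set log := (W.map (algebraMap ℚ ℚ_[p])).formalLog with hlog
  set ℓ : ℚ_[p]⟦X⟧ := PowerSeries.mk fun k ↦ ((W.LFunction k : ℤ) : ℚ_[p]) / k with hℓ
  have hlog0 : constantCoeff log = 0 := constantCoeff_formalLog _
  have hlog1 : coeff 1 log = 1 := coeff_one_formalLog _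
  have hunit : IsUnit (coeff 1 log) := by rw [hlog1]; exact isUnit_one
  have hℓ0 : constantCoeff ℓ = 0 := by
    rw [hℓ, ← coeff_zero_eq_constantCoeff_apply, coeff_mk, Nat.cast_zero, div_zero]
  have hsℓ : HasSubst ℓ := HasSubst.of_constantCoeff_zero' hℓ0
  set inv := log.substInvOfIsUnit hunit with hinv
  have hsinv : HasSubst inv := HasSubst.substInvOfIsUnit log hunit
  set ψ := inv.subst ℓ with hψ
  have hψ0 : constantCoeff ψ = 0 :=
    constantCoeff_subst_eq_zero hℓ0 inv (constantCoeff_substInvOfIsUnit log hunit)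
  have hlogψ : log.subst ψ = ℓ := by
    rw [hψ, ← subst_comp_subst_apply hsinv hsℓ, hinv, subst_substInvOfIsUnit_right log hlog0 hunit,
      subst_X hsℓ]
  refine ⟨ψ, hψ0, fun n ↦ ?_, hlogψ⟩
  -- both `log` and `ℓ` are of Honda type `p − a_pT + T²`, `a_p = LFunction p = frobeniusTrace p`
  have hap : W.LFunction p = W.frobeniusTrace p :=
    LFunction_apply_prime_eq_frobeniusTrace W p (hasGoodReductionAtPrime_of_not_dvd W p hgood)
  have ha : ‖((W.LFunction p : ℤ) : ℚ_[p])‖ ≤ 1 := Padic.norm_int_le_one _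
  have hT₁ : ∀ m, ‖coeff m (hondaShift p ((W.LFunction p : ℤ) : ℚ_[p]) log)‖ ≤ 1 := fun m ↦ by
    have h := norm_coeff_hondaShift_subst_formalLog_le_one' W hgood (θ := PowerSeries.X)
      constantCoeff_X (fun k ↦ by rw [coeff_X]; split_ifs <;> simp) m
    rwa [powerSeries_subst_X_self, ← hap] at h
  have hT₂ := W.norm_coeff_hondaShift_lSeriesLog_le_one hgood
  have h1 : ‖coeff 1 log‖ = 1 := by rw [hlog1, norm_one]
  exact norm_coeff_le_one_of_subst_eq ha hT₁ hT₂ h1 hψ0 hlogψ n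

end WeierstrassCurve
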